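import Literature.AlgebraicGeometry.Resolution.AffineBlowup
import Mathlib.RingTheory.LocalProperties.Reduced
import HarnessLib

/-!
# The blowing up of an integral affine scheme is integral

Topic: `Literature/AlgebraicGeometry/Resolution`. Complement to `AffineBlowup.lean`
(Stacks, Tag 02ND = Lemma 31.33.9: "If `X` is integral, then the blowup `X'` of `X` in a nonzero
quasi-coherent sheaf of ideals is integral"), PROVED for the affine blowing up
`Bl_I(Spec R) = Proj R[It]` of this topic:

* `Proj.isReduced` — `Proj` of a reduced graded ring is reduced (its stalks are homogeneous
  localizations, subrings of localizations);
* `Proj.irreducibleSpace` — `Proj` of a graded domain with nonzero irrelevant ideal is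
  irreducible (the zero ideal is a dense point, `Proj.dense_genericPoint`);
* `affineBlowup.isIntegral` — for a domain `R` and `I ≠ 0`, `Bl_I(Spec R)` is an integral scheme;
* `affineBlowup.surjective` — for a Noetherian domain `R` and `I ≠ 0`, `Bl_I(Spec R) → Spec R` is
  surjective (proper with dense image).

## Sources

* The Stacks Project, Tag 02ND (= Lemma 31.33.9). [StacksProject]
-/

noncomputable section

open AlgebraicGeometry CategoryTheory HomogeneousLocalization

namespace Literature.AlgebraicGeometry.Resolution

universe u

section ProjGeneral

variable {σ : Type*} {A : Type u} [CommRing A] [SetLike σ A] [AddSubgroupClass σ A]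
variable (𝒜 : ℕ → σ) [GradedRing 𝒜]

/-- A homogeneous localization of a reduced graded ring is reduced (it embeds into the ordinary
localization by `HomogeneousLocalization.val`). [folklore] -/
theorem HomogeneousLocalization.isReduced [IsReduced A] (S : Submonoid A) :
    IsReduced (HomogeneousLocalization 𝒜 S) :=
  isReduced_of_injective (algebraMap (HomogeneousLocalization 𝒜 S) (Localization S))
    (HomogeneousLocalization.val_injective S)

/-- **`Proj` of a reduced graded ring is reduced.** [folklore] -/
theorem Proj.isReduced [IsReduced A] : IsReduced (Proj 𝒜) := by
  haveI : ∀ x : Proj 𝒜, _root_.IsReduced ((Proj 𝒜).presheaf.stalk x) := fun x =>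
    haveI := HomogeneousLocalization.isReduced 𝒜 x.asHomogeneousIdeal.toIdeal.primeCompl
    isReduced_of_injective (Proj.stalkIso 𝒜 x).commRingCatIsoToRingEquiv.toRingHom
      (Proj.stalkIso 𝒜 x).commRingCatIsoToRingEquiv.injective
  exact isReduced_of_isReduced_stalk (Proj 𝒜)

/-- **`Proj` of a graded domain with nonzero irrelevant ideal is irreducible** (the zero ideal is
a dense point). [folklore] -/
theorem Proj.irreducibleSpace [IsDomain A] (h : HomogeneousIdeal.irrelevant 𝒜 ≠ ⊥) :
    IrreducibleSpace (Proj 𝒜) := by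
  rw [irreducibleSpace_def, Set.top_eq_univ, ← (Proj.dense_genericPoint 𝒜 h).closure_eq]
  exact isIrreducible_singleton.closure

/-- `Proj` of a graded domain with nonzero irrelevant ideal is an integral scheme. [folklore] -/
theorem Proj.isIntegral [IsDomain A] (h : HomogeneousIdeal.irrelevant 𝒜 ≠ ⊥) :
    IsIntegral (Proj 𝒜) := by
  haveI := Proj.isReduced 𝒜
  haveI := Proj.irreducibleSpace 𝒜 h
  exact isIntegral_of_irreducibleSpace_of_isReduced (Proj 𝒜)

end ProjGeneral

/-- **The blowing up of an integral affine scheme along a nonzero ideal is integral**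
(Stacks 02ND for `Bl_I(Spec R)`). [cite: StacksProject, Tag 02ND] -/
theorem affineBlowup.isIntegral {R : Type u} [CommRing R] [IsDomain R] {I : Ideal R} (hI : I ≠ ⊥) :
    IsIntegral (affineBlowup I) := by
  obtain ⟨a, ha, ha0⟩ := Submodule.exists_mem_ne_zero_of_ne_bot hI
  exact Proj.isIntegral _ (irrelevant_reesGrading_ne_bot a ha ha0)

/-- **The blowing up of a Noetherian integral affine scheme along a nonzero ideal is surjective**
(it is proper, hence closed, and its image contains the dense open `D(a)`, `0 ≠ a ∈ I`, over
which it is an isomorphism). [cite: StacksProject, Tag 02OS] -/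
theorem affineBlowup.surjective {R : Type u} [CommRing R] [IsDomain R] [IsNoetherianRing R]
    {I : Ideal R} (hI : I ≠ ⊥) : Function.Surjective (affineBlowup.π I) := by
  obtain ⟨a, ha, ha0⟩ := Submodule.exists_mem_ne_zero_of_ne_bot hI
  have hclosed : IsClosed (Set.range (affineBlowup.π I)) :=
    (affineBlowup.π I).isClosedMap.isClosed_range
  have hsub : ((PrimeSpectrum.basicOpen a : TopologicalSpace.Opens (PrimeSpectrum R)) :
      Set (PrimeSpectrum R)) ⊆ Set.range (affineBlowup.π I) := by
    intro u hu
    haveI := affineBlowup.isIso_morphismRestrict a ha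
    obtain ⟨v, hv⟩ := (asIso (affineBlowup.π I ∣_ PrimeSpectrum.basicOpen a)).hom.homeomorph.surjective
      ⟨u, hu⟩
    refine ⟨v.1, ?_⟩
    have := morphismRestrict_base_coe (affineBlowup.π I) (PrimeSpectrum.basicOpen a) v
    rw [← this]
    exact congrArg Subtype.val hv
  have : closure ((PrimeSpectrum.basicOpen a : TopologicalSpace.Opens (PrimeSpectrum R)) :
      Set (PrimeSpectrum R)) ⊆ Set.range (affineBlowup.π I) := hclosed.closure_subset_iff.mpr hsub
  rw [(dense_basicOpen_of_ne_zero a ha0).closure_eq] at this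
  exact fun y => this (Set.mem_univ y)

end Literature.AlgebraicGeometry.Resolution

end
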